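import Literature.MathematicalPhysics.QuantumFieldTheory.Balaban1983to89.T4TowerRateDischarge

/-!
# TermwiseAnalyticMarginShrink — leaf T.2 (the ANALYTIC MARGIN) of road P1 for row NE7, shared with row NE9: the located
# prose «the analyticity domains become smaller after each step, but the difference is very small and exponentially
# decreasing in the number of steps» TYPED as the exact missing inequality — a chain of domains shrinking by `d_k` at step
# `k` keeps a closed ball of radius `ϱ₀ − Σ_{i<k} d_i` about every embedded background; with `Σ d ≤ ϱ₀∕2` HALF the initial
# radius SURVIVES all later steps, and `T4TowerRateDischarge.lipBackground_of_analyticMargin` (BY NAME) turns the survivor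
# into node T's `LipBackground` with constant `8E₀∕ϱ₀`

Cell `pub-balaban`, rung (B)+1 sub-cell t4, lineage `b2b-balaban-t4-ne7-p1` (node U5 = NE7, TERM-WISE member;
generation 19), skeleton `HOME/t4/b2b-balaban-t4-ne7-p1-g19/SKELETON-NE7-P1.md` v1.7 §2 NODE T leaf T.2, record
`t4/T4-EST-NE7-P1.md` §25.  HONEST FRAMING (page 1): FIXED FINITE T⁴, rung (B)+1 = the `ε → 0` limit of unit-scale
averaged expectations, CONDITIONAL on BetaPertH and the nine spine estimates (0/9 proved); NOT infinite volume, NOT a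
mass gap, NOT the Clay problem.  NE7 is NOT PRINTED in [Balaban1984PropagatorsI]–[Balaban1989LargeFieldII] and NOT
proved here.  Everything below is a HYPOTHESIS BINDER named in the statement; the theorems are [folklore] (metric
triangle inequality, a geometric series, ONE CALL of the tree's Cauchy step).  No definitions, no cite tags; nothing
printed is asserted.

WHY (skeleton v1.7 §3: OWN-OPEN of road P1 = {T.2 margin, shared with row NE9}).  Node T's background-Lipschitz input
`LipBackground EA W κ CU` is PRODUCED in kernel by `T4TowerRateDischarge.lipBackground_of_analyticMargin` from an
analytic-MARGIN datum `hmargin : ∀ g ∈ W, ∀ X U, closedBall (ι U) (ϱ g (scale X)) ⊆ D g X` — a closed ball of radius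
`ϱ` about EVERY embedded admissible background inside the analyticity domain of the complexified step functional.  Print
(ONE run) gives analyticity on `U^c_j(X, α₀, α₁)` with radii `α_{·,j} ≥ C·g_j·(log g_j^{−2})^q` ([Balaban1988Convergent]
(2.27)(ii)∕(iv), (2.28) p. 259; [Balaban1987RG1] (1.17) p. 263) for the functional AT ITS CREATION; the scale-`j`
functional is then carried through the later steps `j+1, …, K`, and the only printed statement about what remains of its
domain is PROSE: [Balaban1988Convergent] p. 277 «This is the reason for putting the powers of 1∕2 in the conditions
(2.36)–(2.39).  The analyticity domains become smaller after each step, but the difference is very small and exponentially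
decreasing in the number of steps.»  This file TYPES that sentence as the exact inequality the two-run argument needs —
(SHRINK) the domain after `k+1` further steps contains every point whose closed `d_k`-ball lies in the domain after `k`
steps, with `Σ_k d_k ≤ ϱ₀∕2` (e.g. `d_k ≤ c·q^k`, `0 ≤ q < 1`, `c∕(1−q) ≤ ϱ₀∕2`) — and proves that under (SHRINK) half the
creation radius survives every later step, uniformly in their number.  So T.2 ⇐ PRINTED (2.27)∕(2.28) (creation radii,
hypothesis shape) + (SHRINK) (located PROSE p. 277 + the 1∕2-powers of (2.36)–(2.39) p. 261, NO printed inequality — a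
HYPOTHESIS SHAPE, the ONE remaining unprinted input of node T on this road, SHARED with row NE9 whose Cauchy device it
also is) + this bookkeeping + the tree's Cauchy step.

WHAT IS PROVED ([folklore]).
§1 `closedBall_subset_shrinkChain` — a chain `D : ℕ → Set E` with (SHRINK) `∀ k z, closedBall z (d k) ⊆ D k → z ∈ D (k+1)`,
   `0 ≤ d`, and `closedBall x ϱ₀ ⊆ D 0` keeps `closedBall x (ϱ₀ − Σ_{i<k} d i) ⊆ D k` for every `k`;
   `sum_geometric_shrink_le` — `Σ_{i<k} c·q^i ≤ c∕(1−q)`; **`half_radius_survives`** — with `Σ_{i<k} d i ≤ ϱ₀∕2` for all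
   `k`: `closedBall x (ϱ₀∕2) ⊆ D k` for every `k`; `half_radius_survives_geometric` — the instance `d i = c·q^i`,
   `c∕(1−q) ≤ ϱ₀∕2`.
§2 **`lipBackground_of_shrinkingMargin`** — node T's `LipBackground EA W κ (fun g j => 8·E₀ ∕ ϱ₀ g j)` PRODUCED from: the
   embedding `ι` dominated by the carrier's gauge, per `(g, X)` a CHAIN of domains `Dch g X : ℕ → Set E` with the creation
   margin `closedBall (ι U) (ϱ₀ g (scale X)) ⊆ Dch g X 0` for every background (PRINTED-shape (2.27)∕(2.28)), (SHRINK) with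
   decrements `d g X k`, `Σ_{i<k} d g X i ≤ ϱ₀ g (scale X) ∕ 2` for all `k`, and the complexified functional `Ec g X`
   differentiable and bounded by `E₀e^{−κd(X)}` on the FINAL domain `Dch g X (N g X)` (any number `N g X` of later steps),
   agreeing with the real values at embedded backgrounds — ONE CALL of `lipBackground_of_analyticMargin` with
   `ϱ := ϱ₀∕2`.  The constant `8E₀∕ϱ₀(g,j)` is then `polyLipGrowth_of_couplingMargin`'s input exactly as before (the margin
   reading `c₀·g_j ≤ ϱ₀(g,j)`).
§3 `toy_shrinkChain` — non-vacuity: nested balls `D k = closedBall 0 (2 − Σ_{i<k} 2^{−(i+1)})` in `ℂ` satisfy (SHRINK) with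
   `d i = 2^{−(i+1)}`, `Σ ≤ 1 = ϱ₀∕2` for `ϱ₀ = 2`, and the unit ball survives.

NOT DELIVERED: (SHRINK) for Bałaban's renormalised step functionals (the content of p. 277's sentence — NOT PRINTED as an
inequality; shared with row NE9); the creation radii for Bałaban's objects (NODE O).  NOT NE7 (spine 0/9 unchanged), NOT
summit progress.
-/

noncomputable section

open Finset Metric
open scoped BigOperators

namespace Summit.QuantumFields.BalabanUV.T4Continuum.TermwiseAnalyticMarginShrink

open Literature.MathematicalPhysics.QuantumFieldTheory.Balaban1983to89
open T4OutputRate (Carriers Functional LipBackground)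
open T4TowerRateDischarge (lipBackground_of_analyticMargin)

/-! ## §1 A shrinking chain of domains keeps a ball of the surviving radius -/

section Chain

variable {E : Type*} [PseudoMetricSpace E]

/-- **THE SURVIVING BALL.**  If `D 0` contains the closed `ϱ₀`-ball about `x`, every `D (k+1)` contains each point whose
closed `d k`-ball lies in `D k` (the domain shrinks by at most `d k ≥ 0` at step `k`), then `D k` contains the closed ball
of radius `ϱ₀ − Σ_{i<k} d i` about `x`. [folklore] -/
theorem closedBall_subset_shrinkChain (D : ℕ → Set E) (d : ℕ → ℝ) (x : E) {ϱ₀ : ℝ}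
    (h0 : closedBall x ϱ₀ ⊆ D 0) (hshrink : ∀ k z, closedBall z (d k) ⊆ D k → z ∈ D (k + 1)) :
    ∀ k, closedBall x (ϱ₀ - ∑ i ∈ range k, d i) ⊆ D k := by
  intro k
  induction k with
  | zero => simpa using h0
  | succ k ih =>
      intro z hz
      refine hshrink k z fun y hy => ih ?_
      rw [mem_closedBall] at hz hy ⊢
      rw [sum_range_succ] at hz
      calc dist y x ≤ dist y z + dist z x := dist_triangle _ _ _
        _ ≤ d k + (ϱ₀ - (∑ i ∈ range k, d i + d k)) := add_le_add hy hz
        _ = ϱ₀ - ∑ i ∈ range k, d i := by ring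

/-- A geometric shrink sums below `c∕(1−q)`: `Σ_{i<k} c·q^i ≤ c∕(1−q)` for `0 ≤ c`, `0 ≤ q < 1`. [folklore] -/
theorem sum_geometric_shrink_le {c q : ℝ} (hc : 0 ≤ c) (hq0 : 0 ≤ q) (hq1 : q < 1) (k : ℕ) :
    ∑ i ∈ range k, c * q ^ i ≤ c / (1 - q) := by
  rw [← mul_sum, div_eq_mul_inv]
  refine mul_le_mul_of_nonneg_left ?_ hc
  exact sum_le_hasSum (range k) (fun i _ => pow_nonneg hq0 i) (hasSum_geometric_of_lt_one hq0 hq1)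

/-- **HALF THE RADIUS SURVIVES.**  Under the shrink chain with total shrink `Σ_{i<k} d i ≤ ϱ₀∕2` at every `k`, the closed
`ϱ₀∕2`-ball about `x` lies in every `D k`. [folklore] -/
theorem half_radius_survives (D : ℕ → Set E) (d : ℕ → ℝ) (x : E) {ϱ₀ : ℝ} (h0 : closedBall x ϱ₀ ⊆ D 0)
    (hshrink : ∀ k z, closedBall z (d k) ⊆ D k → z ∈ D (k + 1)) (hsum : ∀ k, ∑ i ∈ range k, d i ≤ ϱ₀ / 2) (k : ℕ) :
    closedBall x (ϱ₀ / 2) ⊆ D k :=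
  (closedBall_subset_closedBall (by linarith [hsum k])).trans (closedBall_subset_shrinkChain D d x h0 hshrink k)

/-- The geometric instance: decrements `d i = c·q^i` with `c∕(1−q) ≤ ϱ₀∕2`. [folklore] -/
theorem half_radius_survives_geometric (D : ℕ → Set E) (x : E) {ϱ₀ c q : ℝ} (hc : 0 ≤ c) (hq0 : 0 ≤ q) (hq1 : q < 1)
    (hcq : c / (1 - q) ≤ ϱ₀ / 2) (h0 : closedBall x ϱ₀ ⊆ D 0)
    (hshrink : ∀ k z, closedBall z (c * q ^ k) ⊆ D k → z ∈ D (k + 1)) (k : ℕ) :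
    closedBall x (ϱ₀ / 2) ⊆ D k :=
  half_radius_survives D (fun i => c * q ^ i) x h0 hshrink
    (fun k => (sum_geometric_shrink_le hc hq0 hq1 k).trans hcq) k

end Chain

/-! ## §2 Node T's `LipBackground` from the creation margin and the shrink chain -/

section Lip

variable {C : Carriers} {E : Type*} [NormedAddCommGroup E] [NormedSpace ℂ E]

/-- **`LipBackground` FROM A SHRINKING MARGIN.**  For every admissible coupling sequence `g` and domain `X`: an embedding
`ι` of run-A backgrounds into a complex normed space dominated by the carrier's gauge; a CHAIN of analyticity domains
`Dch g X k` (`k` = number of later steps performed) with the CREATION MARGIN `closedBall (ι U) (ϱ₀ g (scale X)) ⊆ Dch g X 0`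
about every background (the printed-shape radii (2.27)∕(2.28), a hypothesis), the (SHRINK) clause with decrements
`d g X k` whose partial sums stay `≤ ϱ₀ g (scale X) ∕ 2` (p. 277's sentence typed — a hypothesis), and the complexified
functional `Ec g X` differentiable on the FINAL domain `Dch g X (N g X)`, bounded there by `E₀e^{−κd X}`, equal to the
real values at embedded backgrounds.  THEN `LipBackground EA W κ (fun g j => 8·E₀ ∕ ϱ₀ g j)` — the tree's Cauchy step
`lipBackground_of_analyticMargin` at the surviving radius `ϱ₀∕2`. [folklore] -/
theorem lipBackground_of_shrinkingMargin {EA : Functional C C.BgA} {W : Set (ℕ → ℝ)} {κ E₀ : ℝ}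
    (ι : C.BgA → E) (Dch : (ℕ → ℝ) → C.Dom → ℕ → Set E) (N : (ℕ → ℝ) → C.Dom → ℕ) (ϱ₀ : (ℕ → ℝ) → ℕ → ℝ)
    (d : (ℕ → ℝ) → C.Dom → ℕ → ℝ) (Ec : (ℕ → ℝ) → C.Dom → E → ℂ)
    (hϱ₀ : ∀ g ∈ W, ∀ j, 0 < ϱ₀ g j)
    (hcreate : ∀ g ∈ W, ∀ (X : C.Dom) (U : C.BgA), closedBall (ι U) (ϱ₀ g (C.scale X)) ⊆ Dch g X 0)
    (hshrink : ∀ g ∈ W, ∀ (X : C.Dom) (k : ℕ) (z : E), closedBall z (d g X k) ⊆ Dch g X k → z ∈ Dch g X (k + 1))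
    (hsum : ∀ g ∈ W, ∀ (X : C.Dom) (k : ℕ), ∑ i ∈ range k, d g X i ≤ ϱ₀ g (C.scale X) / 2)
    (hhol : ∀ g ∈ W, ∀ X : C.Dom, DifferentiableOn ℂ (Ec g X) (Dch g X (N g X)))
    (hbd : ∀ g ∈ W, ∀ X : C.Dom, ∀ z ∈ Dch g X (N g X), ‖Ec g X z‖ ≤ E₀ * Real.exp (-(κ * C.d X)))
    (hreal : ∀ g ∈ W, ∀ (X : C.Dom) (U : C.BgA), Ec g X (ι U) = (EA g U X : ℂ))
    (hgauge : ∀ U U' : C.BgA, ‖ι U - ι U'‖ ≤ C.gauge U U') :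
    LipBackground EA W κ (fun g j => 8 * E₀ / ϱ₀ g j) := by
  have h := lipBackground_of_analyticMargin (EA := EA) (W := W) (κ := κ) (E₀ := E₀) ι
    (fun g X => Dch g X (N g X)) (fun g j => ϱ₀ g j / 2) Ec (fun g hg j => half_pos (hϱ₀ g hg j)) hhol hbd
    (fun g hg X U => half_radius_survives (Dch g X) (d g X) (ι U) (hcreate g hg X U) (hshrink g hg X) (hsum g hg X)
      (N g X)) hreal hgauge
  have e : (fun g j => 4 * E₀ / (ϱ₀ g j / 2)) = fun g j => 8 * E₀ / ϱ₀ g j := by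
    funext g j
    rw [div_div_eq_mul_div]
    ring
  rw [← e]
  exact h

end Lip

/-! ## §3 Non-vacuity of the shrink chain -/

section Toy

/-- Nested closed balls in `ℂ`: `D k = closedBall 0 (2 − Σ_{i<k} 2^{−(i+1)})` shrink by exactly `d i = (1∕2)^{i+1}` per
step, the partial sums stay `≤ 1 = ϱ₀∕2` for `ϱ₀ = 2`, the creation ball `closedBall 0 2 = D 0`, and the unit ball
survives every step — (SHRINK) is inhabited with a genuinely shrinking chain. [folklore] -/
theorem toy_shrinkChain :
    (∀ k (z : ℂ), closedBall z ((1 / 2 : ℝ) ^ (k + 1))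
        ⊆ closedBall (0 : ℂ) (2 - ∑ i ∈ range k, (1 / 2 : ℝ) ^ (i + 1)) →
      z ∈ closedBall (0 : ℂ) (2 - ∑ i ∈ range (k + 1), (1 / 2 : ℝ) ^ (i + 1))) ∧
    (∀ k, ∑ i ∈ range k, (1 / 2 : ℝ) ^ (i + 1) ≤ 2 / 2) ∧
    (∀ k, closedBall (0 : ℂ) (2 / 2) ⊆ closedBall (0 : ℂ) (2 - ∑ i ∈ range k, (1 / 2 : ℝ) ^ (i + 1))) := by
  have hsum : ∀ k, ∑ i ∈ range k, (1 / 2 : ℝ) ^ (i + 1) ≤ 2 / 2 := fun k => by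
    have h := sum_geometric_shrink_le (c := 1 / 2) (q := 1 / 2) (by norm_num) (by norm_num) (by norm_num) k
    have e : ∑ i ∈ range k, (1 / 2 : ℝ) ^ (i + 1) = ∑ i ∈ range k, 1 / 2 * (1 / 2 : ℝ) ^ i :=
      sum_congr rfl fun i _ => by ring
    rw [e]
    exact h.trans (by norm_num)
  have hshrink : ∀ k (z : ℂ), closedBall z ((1 / 2 : ℝ) ^ (k + 1))
      ⊆ closedBall (0 : ℂ) (2 - ∑ i ∈ range k, (1 / 2 : ℝ) ^ (i + 1)) →
      z ∈ closedBall (0 : ℂ) (2 - ∑ i ∈ range (k + 1), (1 / 2 : ℝ) ^ (i + 1)) := by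
    intro k z hz
    rw [mem_closedBall, dist_zero_right, sum_range_succ]
    -- the point `z + (1/2)^{k+1} · z/‖z‖` (or any point at distance `(1/2)^{k+1}` from `z`) lies in the big ball
    by_cases hz0 : z = 0
    · subst hz0
      have := hsum (k + 1)
      rw [sum_range_succ] at this
      simp only [norm_zero]
      linarith
    · set r : ℝ := (1 / 2 : ℝ) ^ (k + 1) with hr
      have hr0 : 0 < r := by positivity
      have hzn : 0 < ‖z‖ := norm_pos_iff.2 hz0
      set y : ℂ := z + ((r / ‖z‖ : ℝ) : ℂ) * z with hy
      have hyz : dist y z = r := by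
        rw [dist_eq_norm, hy, add_sub_cancel_left, norm_mul, Complex.norm_real, Real.norm_eq_abs,
          abs_of_nonneg (div_nonneg hr0.le hzn.le), div_mul_cancel₀ _ hzn.ne']
      have hyin : y ∈ closedBall z r := by rw [mem_closedBall, hyz]
      have hybig := hz hyin
      rw [mem_closedBall, dist_zero_right] at hybig
      have hny : ‖y‖ = ‖z‖ + r := by
        rw [hy, show z + ((r / ‖z‖ : ℝ) : ℂ) * z = (((1 + r / ‖z‖ : ℝ)) : ℂ) * z by push_cast; ring, norm_mul,
          Complex.norm_real, Real.norm_eq_abs, abs_of_nonneg (by positivity)]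
        field_simp
      linarith
  exact ⟨hshrink, hsum, fun k => closedBall_subset_closedBall (by linarith [hsum k])⟩

end Toy


/-! ## §4 (v1.1) The survivor's constant in the LITERAL shape of node T's next producer -/

section LipShape

variable {C : Carriers} {E : Type*} [NormedAddCommGroup E] [NormedSpace ℂ E]

/-- `lipBackground_of_shrinkingMargin` with its constant written `4·(2E₀)∕ϱ₀` — LITERALLY the `CU` of
`T4TowerRateDischarge.polyLipGrowth_of_couplingMargin` (`fun g j => 4 * E₀ / ϱ g j`) at `E₀ := 2·E₀`, `ϱ := ϱ₀`, so that
node T's two producers (`LipBackground` here, `PolyLipGrowth` there, both consumed by `uRateUpTo_of_nodes`) compose BY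
NAME without a rewrite at the call site. [folklore] -/
theorem lipBackground_of_shrinkingMargin_two {EA : Functional C C.BgA} {W : Set (ℕ → ℝ)} {κ E₀ : ℝ}
    (ι : C.BgA → E) (Dch : (ℕ → ℝ) → C.Dom → ℕ → Set E) (N : (ℕ → ℝ) → C.Dom → ℕ) (ϱ₀ : (ℕ → ℝ) → ℕ → ℝ)
    (d : (ℕ → ℝ) → C.Dom → ℕ → ℝ) (Ec : (ℕ → ℝ) → C.Dom → E → ℂ)
    (hϱ₀ : ∀ g ∈ W, ∀ j, 0 < ϱ₀ g j)
    (hcreate : ∀ g ∈ W, ∀ (X : C.Dom) (U : C.BgA), closedBall (ι U) (ϱ₀ g (C.scale X)) ⊆ Dch g X 0)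
    (hshrink : ∀ g ∈ W, ∀ (X : C.Dom) (k : ℕ) (z : E), closedBall z (d g X k) ⊆ Dch g X k → z ∈ Dch g X (k + 1))
    (hsum : ∀ g ∈ W, ∀ (X : C.Dom) (k : ℕ), ∑ i ∈ range k, d g X i ≤ ϱ₀ g (C.scale X) / 2)
    (hhol : ∀ g ∈ W, ∀ X : C.Dom, DifferentiableOn ℂ (Ec g X) (Dch g X (N g X)))
    (hbd : ∀ g ∈ W, ∀ X : C.Dom, ∀ z ∈ Dch g X (N g X), ‖Ec g X z‖ ≤ E₀ * Real.exp (-(κ * C.d X)))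
    (hreal : ∀ g ∈ W, ∀ (X : C.Dom) (U : C.BgA), Ec g X (ι U) = (EA g U X : ℂ))
    (hgauge : ∀ U U' : C.BgA, ‖ι U - ι U'‖ ≤ C.gauge U U') :
    LipBackground EA W κ (fun g j => 4 * (2 * E₀) / ϱ₀ g j) := by
  have h := lipBackground_of_shrinkingMargin (EA := EA) (W := W) (κ := κ) (E₀ := E₀) ι Dch N ϱ₀ d Ec hϱ₀ hcreate hshrink
    hsum hhol hbd hreal hgauge
  have e : (fun g j => 8 * E₀ / ϱ₀ g j) = fun g j => 4 * (2 * E₀) / ϱ₀ g j := by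
    funext g j
    ring
  rw [← e]
  exact h

end LipShape

end Summit.QuantumFields.BalabanUV.T4Continuum.TermwiseAnalyticMarginShrink
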